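import Summits.QuantumFields.YangMills.Theorems.UnitScaleTiltProp7SigmaRepOfThm2S
import Summits.QuantumFields.YangMills.Theorems.UnitScaleTiltProp7Thm2SocketOfCoverForm
import Summits.QuantumFields.YangMills.Theorems.FluctuationComparisonRegPrIntLS2BetaResidualGauge
import HarnessLib

/-!
# S2β · BRICK 1 OF THE CHART-CURRENCY ROAD — THE Σ-REPRESENTATIVE OF A REGULAR COMPETITOR WITH ITS GAUGE SPLIT `v⁻¹·u` EXPORTED: `v` RESIDUAL (`= 1` at the
# `(K−n)`-centres, descent-preserving), `u` (1.29)-RESTRICTED (`RestrictedPrint`), and the axial row — every member; NO hypothesis at `L ≥ 5`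

Cell `ym3-torus` (YM ladder rung R3 = continuum `SU(2)` Yang–Mills on the three-torus at fixed lattice data — a RUNG: NOT d = 4, NOT infinite volume, NOT a mass gap,
NOT Clay).  Width seat `ym3-torus-px13` (gen 20; px13 g19's parked «v1.1 of `exists_sigmaRep_of_thm2S` exporting `RestrictedPrint`», ★★OWNER g41 №293 «brick 1»).
Crux `stmt-QuantumFields-20520` (`…Theses.UnitScaleTilt.FluctuationComparisonRegPrIntL`), LINE g18-1 S2β, the UNIFORM order of TUBE-REG∘ ∕ GAP♯∘ (px21 g19 UV3-NODE §40.3: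
«print's chart currency — ✓`sigmaGrowth_holds` + a uniform Σ-coordinate ≍ residual-orbit-distance comparison; the first brick is the (1.29) row of the representative's gauge»);
`--kind proof --supports stmt-QuantumFields-20520 --as helper`, count-neutral, DEFINITION-FREE (0 `def`, 0 `instance`, 0 `notation`, 0 `sorry`, default heartbeats).

WHY.  ✓`Prop7SigmaRepOfThm2S.exists_sigmaRep_of_thm2S` (px13 g4) represents every regular competitor `W′ ∈ (6)(e) ∩ 𝔅_k(V)` of `W` as `W′ = g • (e^{iX}·W)` with `X` in
[Balaban1985Variational]'s (19)(20)(21) window — but exports the gauge `g` as a bare `∃`.  Internally `g = v⁻¹·u` where `v` is the axial representative's gauge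
(✓`Prop7AxialReprPrint.exists_repr_inAx_based`: `v = 1` at the `(K−n)`-fold block centres, hence RESIDUAL — it preserves the descent) and `u` is the COV gauge of
[Balaban1985RegularSpaces] Thm 2 carrying the restriction (1.29) (`Prop7SPrint.RestrictedPrint F n K W u`: the `j`-fold covariant averages of `u` are `1` on `Λ_j`,
`j ≤ k`) — the row px13 g4 discarded.  The uniform road needs both BY NAME: the residual factor `v` drops out of the residual-orbit functional, and the (1.29)-restricted
`u` is what (1.36) compares with the Σ-coordinate `X`.

WHAT IS PROVED (composition of landed theorems; the proof of ✓`exists_sigmaRep_of_thm2S` re-run keeping the rows):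
* ★★★ `exists_sigmaRep_split_of_thm2S (hThm2S)` — for `W, W′ ∈ regFibrePr F n K hnK.le e V` (windows `2e ≤ c₁′`, `C0 3·(2e) ≤ ⅓`, `2(2e) ≤ c2' 3 L`): `∃ v u X` with
  (a) `∀ y, v (embIter (K − n) y) = 1` and `∀ U″, descendTo (v • U″) = descendTo U″`; (b) `RestrictedPrint F n K W u`; (c) `IsAxialPrint F n K W (v • W′)`;
  (d) `W′ = (v⁻¹·u) • (emb15 W (expHermField X))` and `v • W′ = u • (emb15 W (expHermField X))`; (e) `In19 F n K (2B₁′e) W (expHermField X) X`, `AvgCondPrint`, `IsLandauPrint`;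
  (f) `wilsonAction4 W′ = wilsonAction4 (emb15 W (expHermField X))`.
* ★★★ `exists_sigmaRep_split_five (L) (h5 : 5 ≤ L)` — the same with the [B8] Thm-2 socket DISCHARGED (✓`Prop7Thm2SocketOfCoverForm.hThm2S_body_of_five_le`): NO hypothesis at `L ≥ 5`.
* `exists_sigmaRep_of_split` — the landed bare-`∃` shape recovered from the split (doorfit: nothing of ✓`exists_sigmaRep_of_thm2S`'s consumers changes).

HONEST: bookkeeping over landed theorems; nothing of the uniform comparison (brick 2), TUBE-REG∘'s uniform order, GAP♯∘, EXW∘, S2β, crux 20520 is proved; `hThm2S` is print's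
[Balaban1985RegularSpaces] Thm 2 in the tree's socket form (a THEOREM at `L ≥ 5`, displayed at `L = 3` — EMBARGO-LITE №58 untouched); no summit statement is proved by a helper;
rung R3 = SU(2) YM₃ on T³ — NOT d = 4, NOT infinite volume, NOT a mass gap, NOT Clay; the Yang–Mills mass gap is NOT proved.  Sorry-free, axioms standard.

References: T. Bałaban, CMP **102** (1985) 277–309 [Balaban1985Variational] ((18)–(21) pp.280–281, Prop. 2 p.281); CMP **99** (1985) 75–102 [Balaban1985RegularSpaces] (Thm 2 p.83,
(1.29) p.81, (1.36)–(1.38) p.82); CMP **98** (1985) 17–51 [Balaban1985Averaging] (Prop. 2 p.26, (11)–(13) p.19).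
-/

set_option autoImplicit false

noncomputable section

open scoped BigOperators Matrix.Norms.L2Operator Matrix

namespace Summit.QuantumFields.YangMills.Theorems.FluctuationComparisonRegPrIntLS2BetaSigmaRepSplit

open Literature.MathematicalPhysics.QuantumFieldTheory.Balaban1983to89
open Literature.MathematicalPhysics.QuantumFieldTheory.Balaban1983to89.T3ContinuumYM3Torus
open Literature.MathematicalPhysics.QuantumFieldTheory.Balaban1983to89.T3UnitLawDensityEML (ℰp)
open Literature.MathematicalPhysics.QuantumFieldTheory.Balaban1983to89.T3TiltDescent (descendTo)
open Literature.MathematicalPhysics.QuantumFieldTheory.Balaban1983to89.T3PrintedRegularMinimiser (RegPr regFibrePr mem_regFibrePr_iff)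
open Literature.MathematicalPhysics.QuantumFieldTheory.Balaban1983to89.T3SectALandauChart (emb15 eta In19 CloseAvg closeAvg_of_mem_fibre)
open Literature.MathematicalPhysics.QuantumFieldTheory.Balaban1983to89.T3UnitLawGaugeInvariance (gaugeAct_gaugeAct)
open T4Continuum
open B7Prop1Explicit renaming Site → LSite
open B7Prop2Explicit (C0 c2' C0_pos c2'_pos)
open B8Thm4TorusAt (torusLam)
open B15DeterminingSets (embIter)
open B8Thm2SetupTorus (Thm2SetupSUAt)
open Summit.QuantumFields.YangMills.Theorems.Prop7TPrint (expHermField)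
open Summit.QuantumFields.YangMills.Theorems.Prop7SPrint (IsAxialPrint RestrictedPrint AvgCondPrint IsLandauPrint)
open Summit.QuantumFields.YangMills.Theorems.Prop7AxialReprPrint (exists_repr_inAx_based inAk_pull_of_regPr)
open Summit.QuantumFields.YangMills.Theorems.Prop7TwistRegauge (gaugeAct_mem_regFibrePr_of_centre_eq descTransf_mul_inv_eq_one)
open Summit.QuantumFields.YangMills.Theorems.Prop7CovOfThm2 (cov_of_thm2SetupSUAt)
open Summit.QuantumFields.YangMills.Theorems.Prop7In19DatumRows (datumRows_of_in19)
open Summit.QuantumFields.YangMills.Theorems.Prop7Thm2SocketOfCoverForm (hThm2S_body_of_five_le)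
open Summit.QuantumFields.YangMills.Theorems.FluctuationComparisonRegPrIntLS2BetaResidualGauge (residual_of_descTransf_eq_one)

/-- ★★★ **THE Σ-REPRESENTATIVE WITH ITS GAUGE SPLIT, FROM `hThm2S`, AT EVERY MEMBER.**  For `W, W′ ∈ (6)(e) ∩ 𝔅_k(V)`: gauges `v` (RESIDUAL: `= 1` at the `(K−n)`-centres,
descent-preserving) and `u` ((1.29)-restricted: `RestrictedPrint F n K W u`) and a Hermitian-traceless `X` in the (19)(20)(21) window with `W′ = (v⁻¹·u) • (e^{iX}·W)`,
`v • W′ = u • (e^{iX}·W)` axial relative to `W`, and `A(W′) = A(e^{iX}·W)`.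
[cite: Balaban1985Variational, Prop. 2 p.281, (18)-(21) pp.280-281; Balaban1985RegularSpaces, Thm 2 p.83, (1.29) p.81, (1.38) p.82; Balaban1985Averaging, Prop. 2 p.26, (11)-(13) p.19] -/
theorem exists_sigmaRep_split_of_thm2S {L : ℕ} {B₁ c₁ : ℝ} (hB₁ : 0 < B₁) (hc₁ : 0 < c₁)
    (hThm2S : ∀ (F : T3Family), F.L = L → ∀ (n K : ℕ), n < K →
      ∃ (β₀ B₂ : ℝ) (len : LSite (F.P K).d → ℝ), Thm2SetupSUAt (F.P K) 2 (K - n) (eta F n K) β₀ B₁ B₂ c₁ len (fun _ => True)) :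
    ∃ B₁' c₁' : ℝ, 0 < B₁' ∧ 0 < c₁' ∧
    ∀ (F : T3Family), F.L = L → ∀ (n K : ℕ) (hnK : n < K) (e : ℝ)
      (V : GaugeField (F.P n) 0 (Matrix.specialUnitaryGroup (Fin 2) ℂ)) (W : GaugeField (F.P K) 0 (Matrix.specialUnitaryGroup (Fin 2) ℂ)),
      0 < e → 2 * e ≤ c₁' → C0 3 * (2 * e) ≤ 1 / 3 → 2 * (2 * e) ≤ c2' 3 L → W ∈ regFibrePr F n K hnK.le e V →
      ∀ W' : GaugeField (F.P K) 0 (Matrix.specialUnitaryGroup (Fin 2) ℂ), W' ∈ regFibrePr F n K hnK.le e V →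
        ∃ (v u : GaugeTransf (F.P K) 0 (Matrix.specialUnitaryGroup (Fin 2) ℂ)) (X : PBond (F.P K) 0 → Matrix (Fin 2) (Fin 2) ℂ),
          (∀ y : Site (F.P K) (K - n), v (embIter (K - n) y) = 1) ∧
          (∀ U'' : GaugeField (F.P K) 0 (Matrix.specialUnitaryGroup (Fin 2) ℂ),
              descendTo F ℰp n K hnK.le (GaugeField.gaugeAct v U'') = descendTo F ℰp n K hnK.le U'') ∧
          RestrictedPrint F n K W u ∧
          IsAxialPrint F n K W (GaugeField.gaugeAct v W') ∧
          W' = GaugeField.gaugeAct (fun x => (v x)⁻¹ * u x) (emb15 W (expHermField X)) ∧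
          GaugeField.gaugeAct v W' = GaugeField.gaugeAct u (emb15 W (expHermField X)) ∧
          In19 F n K (2 * B₁' * e) W (expHermField X) X ∧ AvgCondPrint F n K hnK.le V W X ∧ IsLandauPrint F n K W X ∧
          wilsonAction4 W' = wilsonAction4 (emb15 W (expHermField X)) := by
  obtain ⟨B₁', c₁', hB₁', hc₁', HCOV⟩ := cov_of_thm2SetupSUAt (L := L) (B₃ := 1) zero_le_one hB₁ hc₁ hThm2S
  refine ⟨B₁', c₁', hB₁', hc₁', ?_⟩
  intro F hF n K hnK e V W he h2e hα3 hα2 hW W' hW'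
  have hLP : (F.P K).L = L := by rw [← hF]; rfl
  have hd : (F.P K).d = 3 := rfl
  have hk : K - n ≤ (F.P K).m + (F.P K).K := by show K - n ≤ F.m + K; omega
  -- membership data of the two fibre points
  have hfibW := ((mem_regFibrePr_iff F).1 hW).1
  have hregW : RegPr F n K e W := ((mem_regFibrePr_iff F).1 hW).2
  have hregW' : RegPr F n K e W' := ((mem_regFibrePr_iff F).1 hW').2
  -- (a) the axial representative `W′^v`, `v = 1` at the k-centres ([Balaban1985Averaging] Prop. 2 windows)
  have hα3' : C0 (F.P K).d * (2 * e) ≤ 1 / 3 := by rw [hd]; exact hα3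
  have hα2' : 2 * (2 * e) ≤ c2' (F.P K).d (F.P K).L := by rw [hd, hLP]; exact hα2
  obtain ⟨v, hv1, hvax⟩ := exists_repr_inAx_based (P := F.P K) (by norm_num : (2 : ℕ) ≤ 21) hk he hα3' hα2' W W'
    (inAk_pull_of_regPr F he.le hregW) (inAk_pull_of_regPr F he.le hregW')
  have haxv : IsAxialPrint F n K W (GaugeField.gaugeAct v W') := hvax (torusLam (K - n))
  have hone : GaugeField.gaugeAct (fun _ => (1 : Matrix.specialUnitaryGroup (Fin 2) ℂ)) W' = W' := by
    funext b; simp [GaugeField.gaugeAct]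
  have hWv : GaugeField.gaugeAct v W' ∈ regFibrePr F n K hnK.le e V :=
    gaugeAct_mem_regFibrePr_of_centre_eq F hnK.le he.le (g := v) (u := fun _ => 1) (fun y => by rw [hv1 y]) (X := W') (V := V)
      (by rw [hone]; exact hW')
  -- `v` is residual: `v↓ = 1`
  have hvdesc : T3PrintedRegularOrbits.descTransf F n K hnK.le v = fun _ => 1 := by
    have h1 := descTransf_mul_inv_eq_one F hnK.le (g := v) (u := fun _ => (1 : Matrix.specialUnitaryGroup (Fin 2) ℂ)) (fun y => by rw [hv1 y])
    have h2 : (fun x => v x * ((fun _ => (1 : Matrix.specialUnitaryGroup (Fin 2) ℂ)) x)⁻¹) = v := funext fun x => by simp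
    rw [h2] at h1
    exact h1
  have hvres : ∀ U'' : GaugeField (F.P K) 0 (Matrix.specialUnitaryGroup (Fin 2) ℂ),
      descendTo F ℰp n K hnK.le (GaugeField.gaugeAct v U'') = descendTo F ℰp n K hnK.le U'' :=
    residual_of_descTransf_eq_one F hnK.le hvdesc
  -- (b) COV = [Balaban1985Variational] Prop. 2 from Thm 2, at `(W, W′^v)` with `ε₀ := e`, `ε₁ := e∕L³`, `B₃ := 1`, `ε₂ := 2B₁′e`
  have hL0 : (0 : ℝ) < (L : ℝ) := by
    have : 1 < L := by rw [← hF]; exact F.hL.2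
    exact_mod_cast (by omega : 0 < L)
  have hε₁ : 0 < e / (L : ℝ) ^ 3 := by positivity
  have hprod : (L : ℝ) ^ 3 * (e / (L : ℝ) ^ 3) = e := by field_simp
  have hreg3 : RegPr F n K ((L : ℝ) ^ 3 * 1 * (e / (L : ℝ) ^ 3)) W := by rw [mul_one, hprod]; exact hregW
  have hclose : CloseAvg F n K hnK.le ((L : ℝ) ^ 3 * (e / (L : ℝ) ^ 3)) V W := closeAvg_of_mem_fibre (by positivity) hfibW
  have hsum : e + (L : ℝ) ^ 3 * (e / (L : ℝ) ^ 3) = 2 * e := by rw [hprod]; ring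
  obtain ⟨u, U₁, X, hrestr, hgauge, h19, h20, h21⟩ := HCOV F hF n K hnK e (e / (L : ℝ) ^ 3) (2 * B₁' * e) he hε₁
    (by rw [hsum]; exact h2e) (by rw [hsum]; linarith) V W hreg3 hclose (GaugeField.gaugeAct v W') hWv haxv
  -- (c) `U₁ = e^{iX}`
  obtain ⟨hU₁, -, -, -, -⟩ := datumRows_of_in19 W U₁ X h19
  -- (d) the competitor's gauge `x ↦ v(x)⁻¹u(x)` and gauge invariance of the action
  have h1 : GaugeField.gaugeAct (fun x => (v x)⁻¹ * u x) (emb15 W U₁) = GaugeField.gaugeAct (fun x => (v x)⁻¹) (GaugeField.gaugeAct u (emb15 W U₁)) :=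
    (gaugeAct_gaugeAct _ _ _).symm
  have h2 : (fun x => (v x)⁻¹ * v x) = fun _ => (1 : Matrix.specialUnitaryGroup (Fin 2) ℂ) := funext fun x => inv_mul_cancel _
  have hW'eq : W' = GaugeField.gaugeAct (fun x => (v x)⁻¹ * u x) (emb15 W (expHermField X)) := by
    rw [← hU₁, h1, hgauge, gaugeAct_gaugeAct, h2, hone]
  have hvW' : GaugeField.gaugeAct v W' = GaugeField.gaugeAct u (emb15 W (expHermField X)) := by
    rw [← hU₁]; exact hgauge.symm
  refine ⟨v, u, X, hv1, hvres, hrestr, haxv, hW'eq, hvW', ?_, h20, h21, ?_⟩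
  · rw [← hU₁]; exact h19
  · rw [hW'eq]
    exact T4WilsonGaugeFlatDirection.wilsonAction_gaugeAct 1 _ _

/-- ★★★ **THE SAME WITH THE [B8] THM-2 SOCKET DISCHARGED — NO HYPOTHESIS AT EVERY BLOCK SIZE `L ≥ 5`** (✓`Prop7Thm2SocketOfCoverForm.hThm2S_body_of_five_le`).
[cite: Balaban1985Variational, Prop. 2 p.281; Balaban1985RegularSpaces, Thm 2 p.83, (1.29) p.81; Balaban1985Averaging, Prop. 2 p.26] -/
theorem exists_sigmaRep_split_five (L : ℕ) (h5 : 5 ≤ L) :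
    ∃ B₁' c₁' : ℝ, 0 < B₁' ∧ 0 < c₁' ∧
    ∀ (F : T3Family), F.L = L → ∀ (n K : ℕ) (hnK : n < K) (e : ℝ)
      (V : GaugeField (F.P n) 0 (Matrix.specialUnitaryGroup (Fin 2) ℂ)) (W : GaugeField (F.P K) 0 (Matrix.specialUnitaryGroup (Fin 2) ℂ)),
      0 < e → 2 * e ≤ c₁' → C0 3 * (2 * e) ≤ 1 / 3 → 2 * (2 * e) ≤ c2' 3 L → W ∈ regFibrePr F n K hnK.le e V →
      ∀ W' : GaugeField (F.P K) 0 (Matrix.specialUnitaryGroup (Fin 2) ℂ), W' ∈ regFibrePr F n K hnK.le e V →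
        ∃ (v u : GaugeTransf (F.P K) 0 (Matrix.specialUnitaryGroup (Fin 2) ℂ)) (X : PBond (F.P K) 0 → Matrix (Fin 2) (Fin 2) ℂ),
          (∀ y : Site (F.P K) (K - n), v (embIter (K - n) y) = 1) ∧
          (∀ U'' : GaugeField (F.P K) 0 (Matrix.specialUnitaryGroup (Fin 2) ℂ),
              descendTo F ℰp n K hnK.le (GaugeField.gaugeAct v U'') = descendTo F ℰp n K hnK.le U'') ∧
          RestrictedPrint F n K W u ∧
          IsAxialPrint F n K W (GaugeField.gaugeAct v W') ∧
          W' = GaugeField.gaugeAct (fun x => (v x)⁻¹ * u x) (emb15 W (expHermField X)) ∧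
          GaugeField.gaugeAct v W' = GaugeField.gaugeAct u (emb15 W (expHermField X)) ∧
          In19 F n K (2 * B₁' * e) W (expHermField X) X ∧ AvgCondPrint F n K hnK.le V W X ∧ IsLandauPrint F n K W X ∧
          wilsonAction4 W' = wilsonAction4 (emb15 W (expHermField X)) := by
  obtain ⟨B₁, c₁, hB₁, hc₁, hT⟩ := hThm2S_body_of_five_le L h5
  exact exists_sigmaRep_split_of_thm2S hB₁ hc₁ hT

/-- DOORFIT: the landed bare-`∃` shape of ✓`Prop7SigmaRepOfThm2S.exists_sigmaRep_of_thm2S` follows from the split (nothing of its consumers changes; at `L ≥ 5` it is hypothesis-free).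
[cite: Balaban1985Variational, Prop. 2 p.281; Balaban1985RegularSpaces, Thm 2 p.83] -/
theorem exists_sigmaRep_of_split_five (L : ℕ) (h5 : 5 ≤ L) :
    ∃ B₁' c₁' : ℝ, 0 < B₁' ∧ 0 < c₁' ∧
    ∀ (F : T3Family), F.L = L → ∀ (n K : ℕ) (hnK : n < K) (e : ℝ)
      (V : GaugeField (F.P n) 0 (Matrix.specialUnitaryGroup (Fin 2) ℂ)) (W : GaugeField (F.P K) 0 (Matrix.specialUnitaryGroup (Fin 2) ℂ)),
      0 < e → 2 * e ≤ c₁' → C0 3 * (2 * e) ≤ 1 / 3 → 2 * (2 * e) ≤ c2' 3 L → W ∈ regFibrePr F n K hnK.le e V →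
      ∀ W' : GaugeField (F.P K) 0 (Matrix.specialUnitaryGroup (Fin 2) ℂ), W' ∈ regFibrePr F n K hnK.le e V →
        ∃ (u : GaugeTransf (F.P K) 0 (Matrix.specialUnitaryGroup (Fin 2) ℂ)) (X : PBond (F.P K) 0 → Matrix (Fin 2) (Fin 2) ℂ),
          W' = GaugeField.gaugeAct u (emb15 W (expHermField X)) ∧
          In19 F n K (2 * B₁' * e) W (expHermField X) X ∧ AvgCondPrint F n K hnK.le V W X ∧ IsLandauPrint F n K W X ∧
          wilsonAction4 W' = wilsonAction4 (emb15 W (expHermField X)) := by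
  obtain ⟨B₁', c₁', hB₁', hc₁', H⟩ := exists_sigmaRep_split_five L h5
  refine ⟨B₁', c₁', hB₁', hc₁', fun F hF n K hnK e V W he h2e hα3 hα2 hW W' hW' => ?_⟩
  obtain ⟨v, u, X, -, -, -, -, hW'eq, -, h19, h20, h21, hA⟩ := H F hF n K hnK e V W he h2e hα3 hα2 hW W' hW'
  exact ⟨fun x => (v x)⁻¹ * u x, X, hW'eq, h19, h20, h21, hA⟩

end Summit.QuantumFields.YangMills.Theorems.FluctuationComparisonRegPrIntLS2BetaSigmaRepSplit

end
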